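import Summits.KontsevichZagierPeriods.KontsevichZagierPeriods.Theorems.TerasomaMultiplicationNegativeBranchToMaxCellCells

/-!
# `NegativeBranchToMaxCell` (stmt-KontsevichZagierPeriods-14675) — part 3: the unshear onto the max cell

MOVE 3 of the chain: the inverse of the simplex-side coarea shear `S(σ₁,σ₂) = (σ₁σ₂σ₃, σ₁)`
restricted to the max cell `M₃ = {σ₃ > σ₁, σ₃ > σ₂}` (inside the sheet `σ₂ < σ₃`), written in the
base coordinate `t` (`u = lev t`): `unshear (t, a) = (a, ((3 − a) − √((3 − a)² − 4·lev t/a))/2)`,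
a bijection of the middle cell `{0<t<1, t<a<(3−t)/2}` onto `M₃` — its fibre over `t` is the arc of
the level cubic `σ₁σ₂σ₃ = lev t` from the point `σ₂ = σ₃` (abscissa `a = t = a₁`) to the mirror
point `σ₁ = σ₃` (abscissa `a = (3 − t)/2 = b₁`, since `b₁²(3 − 2b₁) = lev t`). Jacobian
`|det D unshear| = lev′(t)/(a√disc) = lev′(t)/√Q(a, lev t)`, level preserved (`σ₁σ₂σ₃ = lev t`), so
`tFun s = ((σ₁σ₂σ₃)^(s−1) ∘ unshear) · |det|` and
`[midCell, tFun s] − [M₃, (σ₁σ₂σ₃)^(s−1)] ∈ KZ.changeOfVariablesRel` (`unshear_move`).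
Sources: Kontsevich–Zagier 2001 §1.2 rule (2); Andrews–Askey–Roy 1999 §1.8 (Dirichlet's simplex).
-/

noncomputable section

open MeasureTheory Set Real
open scoped BigOperators

namespace Summit.KontsevichZagierPeriods.TerasomaMultiplication.NegativeBranchToMaxCell

open Literature.NumberTheory.Transcendental
open Literature.NumberTheory.Transcendental.KZ
open Literature.ModelTheory.ExponentialFields (IsSemialgebraic)
open MvPolynomial (aeval X C)
open Summit.KontsevichZagierPeriods.TerasomaMultiplication.MultiplicationThreeNegative (simplexFun)

/-! ### The max cell and the discriminant -/

/-- The max cell `M₃ = {σ₁ > 0, σ₂ > 0, σ₁ < σ₃, σ₂ < σ₃}`, `σ₃ = 3 − σ₁ − σ₂` (coordinates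
`x 0 = σ₁`, `x 1 = σ₂`), literally the route's domain clause. [folklore] -/
def maxCell : Set (Fin 2 → ℝ) := {x | 0 < x 0 ∧ 0 < x 1 ∧ x 0 < 3 - x 0 - x 1 ∧ x 1 < 3 - x 0 - x 1}

/-- The discriminant `disc (t, a) = (3 − a)² − 4·lev t/a = (σ₃ − σ₂)²` of `σ² − (3 − a)σ + lev t/a`. [folklore] -/
def disc (x : Fin 2 → ℝ) : ℝ := (3 - x 1) ^ 2 - 4 * lev (x 0) / x 1

/-- `disc = Q(a, lev t)/a²`. [folklore] -/
theorem disc_eq {x : Fin 2 → ℝ} (hx : x 1 ≠ 0) : disc x = Qf (x 1) (lev (x 0)) / (x 1) ^ 2 := by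
  unfold disc Qf
  field_simp

/-- `disc > 0` on the middle cell. [folklore] -/
theorem disc_pos_of_mem_midCell {x : Fin 2 → ℝ} (hx : x ∈ midCell) : 0 < disc x := by
  have ha : 0 < x 1 := by obtain ⟨h0, -, h2, -⟩ := hx; linarith
  rw [disc_eq ha.ne']
  exact div_pos (Qf_pos_of_mem_midCell hx) (by positivity)

/-! ### The unshear `(t, a) ↦ (a, ((3 − a) − √disc)/2)` -/

/-- The unshear map `(t, a) ↦ (σ₁, σ₂) = (a, ((3 − a) − √disc)/2)` (the smaller root: the sheet
`σ₂ < σ₃`). [folklore] -/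
def unshear (x : Fin 2 → ℝ) : Fin 2 → ℝ := ![x 1, ((3 - x 1) - Real.sqrt (disc x)) / 2]

/-- First component. [folklore] -/
@[simp] theorem unshear_apply_zero (x : Fin 2 → ℝ) : unshear x 0 = x 1 := rfl

/-- Second component. [folklore] -/
@[simp] theorem unshear_apply_one (x : Fin 2 → ℝ) :
    unshear x 1 = ((3 - x 1) - Real.sqrt (disc x)) / 2 := rfl

/-- `σ₃ = ((3 − a) + √disc)/2` after the unshear. [folklore] -/
theorem three_sub_unshear (x : Fin 2 → ℝ) :
    3 - unshear x 0 - unshear x 1 = ((3 - x 1) + Real.sqrt (disc x)) / 2 := by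
  simp only [unshear_apply_zero, unshear_apply_one]
  ring

/-- **The level is preserved**: `σ₁σ₂σ₃ = lev t` after the unshear. [folklore] -/
theorem unshear_prod {x : Fin 2 → ℝ} (hx1 : 0 < x 1) (hd : 0 ≤ disc x) :
    unshear x 0 * unshear x 1 * (3 - unshear x 0 - unshear x 1) = lev (x 0) := by
  rw [three_sub_unshear]
  simp only [unshear_apply_zero, unshear_apply_one]
  have hsq : Real.sqrt (disc x) ^ 2 = disc x := Real.sq_sqrt hd
  have : x 1 * (((3 - x 1) - Real.sqrt (disc x)) / 2) * (((3 - x 1) + Real.sqrt (disc x)) / 2) =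
      x 1 * ((3 - x 1) ^ 2 - Real.sqrt (disc x) ^ 2) / 4 := by ring
  rw [this, hsq]
  unfold disc
  have hx0 : x 1 ≠ 0 := hx1.ne'
  field_simp
  ring

/-- Jacobian matrix of the unshear. [folklore] -/
def unshearJac (x : Fin 2 → ℝ) : Matrix (Fin 2) (Fin 2) ℝ :=
  !![0, 1;
    levD (x 0) / (x 1 * Real.sqrt (disc x)),
    (-1 - (-(2 * (3 - x 1)) + 4 * lev (x 0) / x 1 ^ 2) / (2 * Real.sqrt (disc x))) / 2]

/-- Derivative of the unshear. [folklore] -/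
def unshear' (x : Fin 2 → ℝ) : (Fin 2 → ℝ) →L[ℝ] (Fin 2 → ℝ) :=
  LinearMap.toContinuousLinearMap (Matrix.toLin' (unshearJac x))

/-- Derivative applied to a vector, first component. [folklore] -/
@[simp] theorem unshear'_apply_zero (x v : Fin 2 → ℝ) : unshear' x v 0 = v 1 := by
  change Matrix.toLin' (unshearJac x) v 0 = _
  rw [Matrix.toLin'_apply]
  simp [unshearJac, Matrix.mulVec, dotProduct, Fin.sum_univ_two]

/-- Derivative applied to a vector, second component. [folklore] -/
@[simp] theorem unshear'_apply_one (x v : Fin 2 → ℝ) :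
    unshear' x v 1 = levD (x 0) / (x 1 * Real.sqrt (disc x)) * v 0 +
      (-1 - (-(2 * (3 - x 1)) + 4 * lev (x 0) / x 1 ^ 2) / (2 * Real.sqrt (disc x))) / 2 * v 1 := by
  change Matrix.toLin' (unshearJac x) v 1 = _
  rw [Matrix.toLin'_apply]
  simp [unshearJac, Matrix.mulVec, dotProduct, Fin.sum_univ_two]

/-- `det D unshear = −lev′(t)/(a√disc)`. [folklore] -/
theorem det_unshear' (x : Fin 2 → ℝ) :
    (unshear' x).det = -(levD (x 0) / (x 1 * Real.sqrt (disc x))) := by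
  change LinearMap.det (Matrix.toLin' (unshearJac x)) = _
  rw [LinearMap.det_toLin', Matrix.det_fin_two]
  simp [unshearJac]

/-- The unshear is differentiable where `a ≠ 0` and `disc > 0`, with derivative `unshear'`. [folklore] -/
theorem hasFDerivAt_unshear {x : Fin 2 → ℝ} (hx1 : x 1 ≠ 0) (hd : 0 < disc x) :
    HasFDerivAt unshear (unshear' x) x := by
  have h0 : HasFDerivAt (fun y : Fin 2 → ℝ => y 0)
      (ContinuousLinearMap.proj (R := ℝ) (φ := fun _ : Fin 2 => ℝ) 0) x := hasFDerivAt_apply 0 x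
  have h1 : HasFDerivAt (fun y : Fin 2 → ℝ => y 1)
      (ContinuousLinearMap.proj (R := ℝ) (φ := fun _ : Fin 2 => ℝ) 1) x := hasFDerivAt_apply 1 x
  have hR : Real.sqrt (disc x) ≠ 0 := (Real.sqrt_pos.2 hd).ne'
  rw [hasFDerivAt_pi']
  refine Fin.forall_fin_two.mpr ⟨?_, ?_⟩
  · have hf : (fun y : Fin 2 → ℝ => unshear y 0) = fun y => y 1 := funext fun y => rfl
    rw [hf]
    exact h1.congr_fderiv (ContinuousLinearMap.ext fun v => by simp)
  · have hlev : HasFDerivAt (fun y : Fin 2 → ℝ => lev (y 0))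
        ((ContinuousLinearMap.smulRight (1 : ℝ →L[ℝ] ℝ) (levD (x 0))).comp
          (ContinuousLinearMap.proj (R := ℝ) (φ := fun _ : Fin 2 => ℝ) 0)) x :=
      ((hasDerivAt_lev (x 0)).hasFDerivAt.comp x h0 :)
    have hinv : HasFDerivAt (fun y : Fin 2 → ℝ => (y 1)⁻¹)
        ((ContinuousLinearMap.smulRight (1 : ℝ →L[ℝ] ℝ) (-((x 1) ^ 2)⁻¹)).comp
          (ContinuousLinearMap.proj (R := ℝ) (φ := fun _ : Fin 2 => ℝ) 1)) x :=
      (hasFDerivAt_inv hx1).comp x h1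
    have hfun : disc = fun y : Fin 2 → ℝ => (3 - y 1) * (3 - y 1) - 4 * lev (y 0) * (y 1)⁻¹ := by
      funext y; simp only [disc, div_eq_mul_inv, sq]
    have hdisc : HasFDerivAt disc
        ((3 - x 1) • (-(ContinuousLinearMap.proj (R := ℝ) (φ := fun _ : Fin 2 => ℝ) 1)) +
            (3 - x 1) • (-(ContinuousLinearMap.proj (R := ℝ) (φ := fun _ : Fin 2 => ℝ) 1)) -
          ((4 * lev (x 0)) •
              ((ContinuousLinearMap.smulRight (1 : ℝ →L[ℝ] ℝ) (-((x 1) ^ 2)⁻¹)).comp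
                (ContinuousLinearMap.proj (R := ℝ) (φ := fun _ : Fin 2 => ℝ) 1)) +
            (x 1)⁻¹ • ((4:ℝ) • ((ContinuousLinearMap.smulRight (1 : ℝ →L[ℝ] ℝ) (levD (x 0))).comp
              (ContinuousLinearMap.proj (R := ℝ) (φ := fun _ : Fin 2 => ℝ) 0))))) x := by
      rw [hfun]
      exact ((h1.const_sub 3).mul (h1.const_sub 3)).sub ((hlev.const_mul (4:ℝ)).mul hinv)
    have hsqrt := hdisc.sqrt hd.ne'
    have hfin := ((h1.const_sub 3).sub hsqrt).const_mul (2:ℝ)⁻¹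
    have hf : (fun y : Fin 2 → ℝ => unshear y 1) =
        fun y => (2:ℝ)⁻¹ * ((3 - y 1) - Real.sqrt (disc y)) := by
      funext y; simp only [unshear_apply_one]; ring
    rw [hf]
    refine hfin.congr_fderiv (ContinuousLinearMap.ext fun v => ?_)
    simp
    field_simp
    ring

/-! ### The unshear maps the middle cell bijectively onto the max cell -/

/-- The unshear maps the middle cell into the max cell. [folklore] -/
theorem mapsTo_unshear : MapsTo unshear midCell maxCell := by
  intro x hx
  have hdpos := disc_pos_of_mem_midCell hx
  obtain ⟨h0, h1, h2, h3⟩ := hx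
  have ha : 0 < x 1 := by linarith
  simp only [maxCell, mem_setOf_eq, unshear_apply_zero, unshear_apply_one]
  have hRpos : 0 < Real.sqrt (disc x) := Real.sqrt_pos.2 hdpos
  have hRsq : Real.sqrt (disc x) ^ 2 = disc x := Real.sq_sqrt hdpos.le
  set R := Real.sqrt (disc x) with hR
  have hdisc : disc x = (3 - x 1) ^ 2 - 4 * lev (x 0) / x 1 := rfl
  have hlevpos : 0 < lev (x 0) := (lev_mem_Ioo ⟨h0, h1⟩).1
  -- `R < 3 − a`, i.e. `σ₂ > 0`
  have hR3 : R < 3 - x 1 := by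
    have h4 : 0 < 4 * lev (x 0) / x 1 := by positivity
    have hlt : R ^ 2 < (3 - x 1) ^ 2 := by rw [hRsq, hdisc]; linarith
    exact lt_of_pow_lt_pow_left₀ 2 (by linarith) hlt
  -- `3a − 3 < R`, i.e. `σ₁ < σ₃`
  have hR1 : 3 * x 1 - 3 < R := by
    rcases le_or_gt (x 1) 1 with hle | hlt
    · linarith
    · have hb0 : 0 < 3 - 2 * x 1 := by linarith
      have hb1 : 3 - 2 * x 1 ≤ 1 := by linarith
      have htb : x 0 < 3 - 2 * x 1 := by linarith
      have hlt2 : lev (x 0) < lev (3 - 2 * x 1) := lev_lt_lev h0 htb hb1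
      have hid : R ^ 2 - (3 * x 1 - 3) ^ 2 = 4 * (lev (3 - 2 * x 1) - lev (x 0)) / x 1 := by
        rw [hRsq, hdisc]
        unfold lev
        have hx0 : x 1 ≠ 0 := ha.ne'
        field_simp
        ring
      have hpos : 0 < R ^ 2 - (3 * x 1 - 3) ^ 2 := by
        rw [hid]; exact div_pos (by linarith) ha
      exact lt_of_pow_lt_pow_left₀ 2 hRpos.le (by linarith)
  refine ⟨ha, by linarith, by linarith, by linarith⟩

/-- The unshear maps the middle cell ONTO the max cell: every point of `M₃` lies on the lower arc
of its level oval, strictly between the abscissae `a₁ = t` and `b₁ = (3 − t)/2`. [folklore] -/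
theorem surjOn_unshear : SurjOn unshear midCell maxCell := by
  intro y hy
  obtain ⟨ha, hs2, h13, h23⟩ := hy
  have hy0 : y 0 ≠ 0 := ha.ne'
  have hσ3 : 0 < 3 - y 0 - y 1 := by linarith
  have hu0 : 0 < y 0 * y 1 * (3 - y 0 - y 1) := by positivity
  -- `u < lev a ≤ 1`
  have hulev : y 0 * y 1 * (3 - y 0 - y 1) < lev (y 0) := by
    have hsq : 0 < (3 - y 0 - y 1 - y 1) ^ 2 := by
      have : (3 - y 0 - y 1 - y 1) ≠ 0 := by linarith
      positivity
    have hid : lev (y 0) - y 0 * y 1 * (3 - y 0 - y 1) = y 0 * (3 - y 0 - y 1 - y 1) ^ 2 / 4 := by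
      unfold lev; ring
    nlinarith [mul_pos ha hsq]
  have hlev1 : lev (y 0) ≤ 1 := by
    have h := one_sub_lev (y 0)
    have : 0 ≤ (1 - y 0) ^ 2 * (4 - y 0) / 4 := by
      have : 0 ≤ 4 - y 0 := by linarith
      positivity
    linarith
  obtain ⟨t, ht, htu⟩ := exists_lev_eq hu0 (by linarith)
  -- `t < a`
  have hta : t < y 0 := by
    refine not_le.mp fun hle => ?_
    have : lev (y 0) ≤ lev t := by
      rcases eq_or_lt_of_le hle with h | h
      · rw [h]
      · exact (lev_lt_lev ha h ht.2.le).le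
    linarith
  -- `2a < 3 − t`
  have htb : 2 * y 0 < 3 - t := by
    rcases le_or_gt (y 0) 1 with hle | hlt
    · linarith [ht.2]
    · have hb0 : 0 < 3 - 2 * y 0 := by linarith
      have hkey : y 0 * y 1 * (3 - y 0 - y 1) < lev (3 - 2 * y 0) := by
        have hneg : (3 - y 0 - y 1 - y 0) * (y 1 - y 0) < 0 :=
          mul_neg_of_pos_of_neg (by linarith) (by linarith)
        have hid : y 0 * y 1 * (3 - y 0 - y 1) - lev (3 - 2 * y 0) =
            y 0 * ((3 - y 0 - y 1 - y 0) * (y 1 - y 0)) := by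
          unfold lev; ring
        nlinarith [mul_neg_of_pos_of_neg ha hneg]
      refine not_le.mp fun hle => ?_
      have : lev (3 - 2 * y 0) ≤ lev t := by
        rcases eq_or_lt_of_le (by linarith : 3 - 2 * y 0 ≤ t) with h | h
        · rw [h]
        · exact (lev_lt_lev hb0 h ht.2.le).le
      linarith
  refine ⟨![t, y 0], ⟨ht.1, ht.2, by simpa using hta, by simpa using htb⟩, ?_⟩
  have hdisc : disc ![t, y 0] = (3 - y 0 - y 1 - y 1) ^ 2 := by
    simp only [disc, Matrix.cons_val_zero, Matrix.cons_val_one, htu]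
    field_simp
    ring
  funext i
  fin_cases i
  · simp
  · simp only [Fin.mk_one, unshear_apply_one, hdisc,
      Real.sqrt_sq (by linarith : (0:ℝ) ≤ 3 - y 0 - y 1 - y 1)]
    simp
    ring

/-- The unshear is injective on the middle cell. [folklore] -/
theorem injOn_unshear : InjOn unshear midCell := by
  intro x hx y hy hxy
  have e0 : x 1 = y 1 := by simpa using congrFun hxy 0
  have hdx := disc_pos_of_mem_midCell hx
  have hdy := disc_pos_of_mem_midCell hy
  have e1 : Real.sqrt (disc x) = Real.sqrt (disc y) := by
    have := congrFun hxy 1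
    simp only [unshear_apply_one, e0] at this
    linarith
  rw [Real.sqrt_inj hdx.le hdy.le] at e1
  simp only [disc, e0] at e1
  have ha : y 1 ≠ 0 := by
    have : 0 < y 1 := by obtain ⟨h0, -, h2, -⟩ := hy; linarith
    exact this.ne'
  have e2 : 4 * lev (x 0) / y 1 = 4 * lev (y 0) / y 1 := by linarith
  rw [div_left_inj' ha] at e2
  have h0 : x 0 = y 0 := lev_injOn ⟨hx.1, hx.2.1⟩ ⟨hy.1, hy.2.1⟩ (by linarith)
  funext i
  fin_cases i
  · exact h0
  · exact e0

/-- The unshear maps the middle cell ONTO the max cell (as an image identity). [folklore] -/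
theorem image_unshear_midCell : unshear '' midCell = maxCell :=
  mapsTo_unshear.image_subset.antisymm surjOn_unshear

/-- The unshear is a `ℚ`-semialgebraic map on the middle cell (rational functions and one square
root; the tree's `fun_sqrt`, Tarski–Seidenberg inside). [folklore] -/
theorem isSemialgebraicMapOn_unshear : IsSemialgebraicMapOn ℚ midCell unshear := by
  refine IsSemialgebraicMapOn.of_forall isSemialgebraic_midCell (Fin.forall_fin_two.mpr ⟨?_, ?_⟩)
  · exact (isSemialgebraicFunOn_aeval isSemialgebraic_midCell (X 1)).congr fun x _ => by simp
  · have hdisc : IsSemialgebraicFunOn ℚ midCell disc := by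
      refine (isSemialgebraicFunOn_aeval_div_aeval isSemialgebraic_midCell
        ((3 - X 1) ^ 2 * X 1 - 4 * levPoly : MvPolynomial (Fin 2) ℚ) (X 1) fun x hx => ?_).congr
        fun x hx => ?_
      · simpa using (show (0:ℝ) < x 1 by obtain ⟨h0, -, h2, -⟩ := hx; linarith).ne'
      · have ha : x 1 ≠ 0 := (show (0:ℝ) < x 1 by obtain ⟨h0, -, h2, -⟩ := hx; linarith).ne'
        simp only [map_sub, map_mul, map_pow, MvPolynomial.aeval_X, aeval_levPoly, disc, map_ofNat]
        field_simp
    have h3 : IsSemialgebraicFunOn ℚ midCell (fun x => 3 - x 1) :=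
      (isSemialgebraicFunOn_aeval isSemialgebraic_midCell (3 - X 1)).congr fun x _ => by simp
    exact ((h3.fun_sub hdisc.fun_sqrt).div (isSemialgebraicFunOn_const_ofNat isSemialgebraic_midCell 2)
      fun _ _ => two_ne_zero).congr fun x _ => rfl

/-! ### The Jacobian identity and the move -/

/-- **Jacobian identity of move 3**: on the middle cell,
`tFun s = ((σ₁σ₂σ₃)^(s−1) ∘ unshear) · |det D unshear|`. [folklore] -/
theorem tFun_eq_simplexFun_unshear {s : ℚ} {x : Fin 2 → ℝ} (hx : x ∈ midCell) :
    tFun s x = simplexFun s (unshear x) * |(unshear' x).det| := by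
  have hdpos := disc_pos_of_mem_midCell hx
  have ha : 0 < x 1 := by obtain ⟨h0, -, h2, -⟩ := hx; linarith
  have ht1 : x 0 < 1 := hx.2.1
  have hR : 0 < Real.sqrt (disc x) := Real.sqrt_pos.2 hdpos
  have hprod := unshear_prod ha hdpos.le
  have hsqrtQ : Real.sqrt (Qf (x 1) (lev (x 0))) = x 1 * Real.sqrt (disc x) := by
    have hQ : Qf (x 1) (lev (x 0)) = (x 1) ^ 2 * disc x := by
      rw [disc_eq ha.ne']
      field_simp
    rw [hQ, Real.sqrt_mul (sq_nonneg _), Real.sqrt_sq ha.le]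
  have hlD := levD_pos ht1
  rw [det_unshear', abs_neg, abs_of_pos (by positivity)]
  simp only [simplexFun]
  rw [hprod]
  simp only [tFun]
  rw [hsqrtQ]
  have hx0 : x 1 ≠ 0 := ha.ne'
  have hR0 : Real.sqrt (disc x) ≠ 0 := hR.ne'
  field_simp

/-- **Move 3 is ONE rule-(2) instance**: for any representations `R = [midCell, tFun s]` and
`r' = [M₃, (σ₁σ₂σ₃)^(s−1)]` (integrands pinned on the domain only),
`[R] − [r'] ∈ changeOfVariablesRel` along the unshear. [cite: KontsevichZagier2001, §1.2 rule (2)] -/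
theorem unshear_move {s : ℚ} (R r' : IntegralRep 2) (hR : R.domain = midCell)
    (hRi : EqOn R.integrand (tFun s) R.domain) (hr' : r'.domain = maxCell)
    (hr'i : EqOn r'.integrand (simplexFun s) r'.domain) : of R - of r' ∈ changeOfVariablesRel := by
  refine ⟨2, R, r', unshear, unshear', ?_, fun x hx => ?_, ?_, ?_, fun x hx => ?_, rfl⟩
  · rw [hR]; exact isSemialgebraicMapOn_unshear
  · rw [hR] at hx
    have ha : x 1 ≠ 0 := (show (0:ℝ) < x 1 by obtain ⟨h0, -, h2, -⟩ := hx; linarith).ne'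
    exact (hasFDerivAt_unshear ha (disc_pos_of_mem_midCell hx)).hasFDerivWithinAt
  · rw [hR]; exact injOn_unshear
  · rw [hr', hR, image_unshear_midCell]
  · have hx' : x ∈ midCell := hR ▸ hx
    rw [hRi hx, hr'i (by rw [hr']; exact mapsTo_unshear hx'), tFun_eq_simplexFun_unshear hx']

end Summit.KontsevichZagierPeriods.TerasomaMultiplication.NegativeBranchToMaxCell

end
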